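import Mathlib
import Summits.NavierStokesRegularity.NavierStokesRegularity.Theorems.FilamentSkeletonRssAreaLawSlavingHoloKernel

/-!
# Area-law slaving, complex part 2 — the regular solution AT AN ARBITRARY SINGULAR POINT of a CONVEX domain, and its REAL TRACE
# (`FilamentSkeletonRss`, child crux `TangentSkeletonNearStraight`, stmt-NavierStokesRegularity-28295, line
# `child_tangent_analytic_strip`, ∃-side of the registered stub `stub_analyticClosing`: the `StadiumAnalyticArea` conjunct)

Part 1 (`Theorems.AreaLawSlavingHolo.singular_regular_solution_holo`) solves `z·A′ = a·A + b` holomorphically on an open set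
star-shaped with respect to the singular point `0`.  The stadium `{|Im z| < hs, |Re z − cc| < L + hs}` of the line is CONVEX and the
singular point is the slip zero `c` on its real trace, and the area law has REAL coefficients there.  This file supplies the two
book-keeping steps between part 1 and the `StadiumAnalyticArea` conjunct:

* `star_of_convex` — a convex set is star-shaped (in the multiplicative form used by part 1) about each of its points after
  translation; `singular_regular_solution_holo_at` — for `U` open convex, `c ∈ U`, `a, b` holomorphic on `U`, `a(c) = −ν < 0`:
  a function `A` holomorphic on `U` with `(z − c)·A′(z) = a(z)A(z) + b(z)` on `U` and `A(c) = b(c)/ν` (translate part 1);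
* `im_deriv_eq_zero_of_real_trace` — a holomorphic function that is real on the real trace of an open set has a real
  derivative there; `hasDerivAt_re_trace` — its real trace `x ↦ Re g(x)` is differentiable with derivative `Re g′(x)`;
* `real_trace_solution` — consequently, if `A` solves `(z − c)·A′ = a·A + b` on `U` and `a, A` are real on the real trace,
  then `x ↦ Re A(x)` is a differentiable real solution of `(x − c)·A′ = (Re a)·A + (Re b)` on the (open) real trace
  `{x : ℝ | ↑x ∈ U}` — the form in which the real area law of `FlatJ1G` is stated.

Left for the conjunct (census): realness of the part-1 solution from realness of `a, b` (formula-level bookkeeping), local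
uniqueness on the trace interval (to identify with the slaved area of `Theorems.AreaLawSlaving` part 2), and the factor-two
window `Aa/2 ≤ Re G`, `|G| ≤ 2·Aa` on a thin stadium.

HONEST FRAMING: classical complex analysis serving a HYPOTHETICAL filament skeleton on the NEGATIVE side of a MODEL route; no
registered stub is closed by this file and nothing here bears on Navier–Stokes regularity or blow-up.
`--supports stmt-NavierStokesRegularity-28295`.
-/

set_option linter.dupNamespace false

noncomputable section

namespace Summit.NavierStokesRegularity.NavierStokesRegularity.Theorems.AreaLawSlavingHolo

open Set MeasureTheory Metric Filter
open scoped Topology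

/-! ## §1 Translation to an arbitrary singular point of a convex domain -/

/-- A convex set, translated so that one of its points `c` becomes the origin, is star-shaped with respect to `0` in the
multiplicative form of part 1: `t·z` stays in `U − c` for `t ∈ [0,1]`. [folklore] -/
theorem star_of_convex {U : Set ℂ} (hU : Convex ℝ U) {c : ℂ} (hc : c ∈ U) :
    ∀ z ∈ (fun z => z - c) '' U, ∀ t : ℝ, t ∈ Icc (0:ℝ) 1 → (t : ℂ) * z ∈ (fun z => z - c) '' U := by
  rintro _ ⟨u, hu, rfl⟩ t ⟨ht0, ht1⟩
  refine ⟨c + t • (u - c), ?_, by simp [Complex.real_smul]⟩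
  have h := hU.add_smul_sub_mem hc hu ⟨ht0, ht1⟩
  exact h

/-- The translate of an open set is open, in the image form used above. [folklore] -/
theorem isOpen_image_sub {U : Set ℂ} (hU : IsOpen U) (c : ℂ) : IsOpen ((fun z => z - c) '' U) := by
  have : (fun z => z - c) '' U = (fun z => z + c) ⁻¹' U := by
    ext z
    constructor
    · rintro ⟨u, hu, rfl⟩; simpa using hu
    · intro hz; exact ⟨z + c, hz, by ring⟩
  rw [this]
  exact hU.preimage (continuous_id.add continuous_const)

/-- **Holomorphic regular solution at the singular point `c` of a convex domain.**  `U ⊆ ℂ` open and convex, `c ∈ U`,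
`a, b` holomorphic on `U`, `a(c) = −ν` with `ν > 0`.  Then there is `A` holomorphic on `U` with
`(z − c)·A′(z) = a(z)·A(z) + b(z)` for `z ∈ U` and `A(c) = b(c)/ν`. [Coddington–Levinson 1955, Ch. 4 §1; folklore] -/
theorem singular_regular_solution_holo_at {U : Set ℂ} (hUo : IsOpen U) (hUc : Convex ℝ U) {c : ℂ} (hc : c ∈ U)
    {ν : ℝ} (hν : 0 < ν) {a b : ℂ → ℂ} (ha : DifferentiableOn ℂ a U) (hb : DifferentiableOn ℂ b U) (hac : a c = -ν) :
    ∃ A : ℂ → ℂ, DifferentiableOn ℂ A U ∧ (∀ z ∈ U, (z - c) * deriv A z = a z * A z + b z) ∧ A c = b c / ν := by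
  set V : Set ℂ := (fun z => z - c) '' U with hV
  have hVo : IsOpen V := isOpen_image_sub hUo c
  have hstar := star_of_convex hUc hc
  -- translated coefficients
  have hsh : ∀ {g : ℂ → ℂ}, DifferentiableOn ℂ g U → DifferentiableOn ℂ (fun z => g (z + c)) V := by
    intro g hg
    refine (hg.comp ((differentiable_id.add_const c).differentiableOn) ?_)
    rintro _ ⟨u, hu, rfl⟩; simpa using hu
  obtain ⟨A, hA, hODE, hA0⟩ := singular_regular_solution_holo hVo hstar hν (hsh ha) (hsh hb) (by simpa using hac)
  refine ⟨fun z => A (z - c), ?_, fun z hz => ?_, by simpa using hA0⟩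
  · refine hA.comp ((differentiable_id.sub_const c).differentiableOn) fun z hz => ⟨z, hz, rfl⟩
  · have hzV : z - c ∈ V := ⟨z, hz, rfl⟩
    have h1 := hODE (z - c) hzV
    simp only [sub_add_cancel] at h1
    have hd : deriv (fun z => A (z - c)) z = deriv A (z - c) := by
      have hAd : DifferentiableAt ℂ A (z - c) := hA.differentiableAt (hVo.mem_nhds hzV)
      have := (hAd.hasDerivAt.comp z ((hasDerivAt_id z).sub_const c))
      simp only [mul_one] at this
      exact this.deriv
    rw [hd]
    exact h1

/-! ## §2 The real trace of a holomorphic function that is real on the reals -/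

/-- The real trace `{x : ℝ | ↑x ∈ U}` of an open set is open. [folklore] -/
theorem isOpen_real_trace {U : Set ℂ} (hU : IsOpen U) : IsOpen {x : ℝ | (x : ℂ) ∈ U} :=
  hU.preimage Complex.continuous_ofReal

/-- **A holomorphic function real on the real trace has a real derivative there.**  If `g` is complex-differentiable on
the open `U` and `Im g(x) = 0` for all real `x` with `↑x ∈ U`, then `Im g′(x) = 0` at such `x`. [folklore] -/
theorem im_deriv_eq_zero_of_real_trace {U : Set ℂ} (hU : IsOpen U) {g : ℂ → ℂ} (hg : DifferentiableOn ℂ g U)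
    (hreal : ∀ x : ℝ, (x : ℂ) ∈ U → (g x).im = 0) {x : ℝ} (hx : (x : ℂ) ∈ U) : (deriv g x).im = 0 := by
  -- restrict to the real direction
  have h1 : HasDerivAt g (deriv g x) (x : ℂ) := (hg.differentiableAt (hU.mem_nhds hx)).hasDerivAt
  have h2 : HasDerivAt (fun t : ℝ => g t) (deriv g x) x := h1.comp_ofReal
  -- the imaginary part of the real-direction function vanishes near `x`
  have h3 : HasDerivAt (fun t : ℝ => (g t).im) ((deriv g x).im) x :=
    Complex.imCLM.hasFDerivAt.comp_hasDerivAt x h2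
  have h4 : (fun t : ℝ => (g t).im) =ᶠ[𝓝 x] fun _ => (0:ℝ) := by
    filter_upwards [(isOpen_real_trace hU).mem_nhds hx] with t ht
    exact hreal t ht
  have h5 : HasDerivAt (fun _ : ℝ => (0:ℝ)) ((deriv g x).im) x := h3.congr_of_eventuallyEq h4.symm
  have h6 := h5.unique (hasDerivAt_const x (0:ℝ))
  exact h6

/-- **The real trace is differentiable with the real part of the complex derivative.**  Under the same hypotheses,
`t ↦ Re g(t)` has derivative `Re g′(x)` at every point `x` of the real trace. [folklore] -/
theorem hasDerivAt_re_trace {U : Set ℂ} (hU : IsOpen U) {g : ℂ → ℂ} (hg : DifferentiableOn ℂ g U)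
    {x : ℝ} (hx : (x : ℂ) ∈ U) : HasDerivAt (fun t : ℝ => (g t).re) ((deriv g x).re) x := by
  have h1 : HasDerivAt g (deriv g x) (x : ℂ) := (hg.differentiableAt (hU.mem_nhds hx)).hasDerivAt
  have h2 : HasDerivAt (fun t : ℝ => g t) (deriv g x) x := h1.comp_ofReal
  exact Complex.reCLM.hasFDerivAt.comp_hasDerivAt x h2

/-- **Real trace of the singular equation.**  Let `A` solve `(z − c)·A′(z) = a(z)·A(z) + b(z)` on the open `U` (`c` real),
with `A` holomorphic on `U` and `a, A` real on its real trace (then `b` is real there automatically).  Then the real function `x ↦ Re A(x)` is differentiable on the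
real trace with derivative `Re A′(x)` and solves `(x − c)·(Re A)′(x) = Re a(x)·Re A(x) + Re b(x)` there. [folklore] -/
theorem real_trace_solution {U : Set ℂ} (hU : IsOpen U) {c : ℝ} {a b A : ℂ → ℂ} (hA : DifferentiableOn ℂ A U)
    (hODE : ∀ z ∈ U, (z - c) * deriv A z = a z * A z + b z)
    (ha_re : ∀ x : ℝ, (x : ℂ) ∈ U → (a x).im = 0)
    (hA_re : ∀ x : ℝ, (x : ℂ) ∈ U → (A x).im = 0) {x : ℝ} (hx : (x : ℂ) ∈ U) :
    HasDerivAt (fun t : ℝ => (A t).re) ((deriv A x).re) x ∧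
      (x - c) * deriv (fun t : ℝ => (A t).re) x = (a x).re * (A x).re + (b x).re := by
  have hd := hasDerivAt_re_trace hU hA hx
  refine ⟨hd, ?_⟩
  rw [hd.deriv]
  have hA'im : (deriv A x).im = 0 := im_deriv_eq_zero_of_real_trace hU hA hA_re hx
  have h := hODE x hx
  -- take real parts of the complex identity
  have hre := congrArg Complex.re h
  simp only [Complex.mul_re, Complex.sub_re, Complex.ofReal_re, Complex.sub_im, Complex.ofReal_im, sub_zero,
    Complex.add_re, hA'im, mul_zero, ha_re x hx, hA_re x hx] at hre
  linarith

end Summit.NavierStokesRegularity.NavierStokesRegularity.Theorems.AreaLawSlavingHolo
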